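import Summits.CriticalPhenomena.CardyFormulaZ2.Theorems.CardyFlipRussoCoveringLegShiftDefs
import Summits.CriticalPhenomena.CardyFormulaZ2.Theorems.CardyFlipRussoCoveringLegStubCoveringBridge
import Summits.CriticalPhenomena.CardyFormulaZ2.Theorems.CardyFlipRussoCoveringLegStubCoverLowerShift
import Summits.CriticalPhenomena.CardyFormulaZ2.Theorems.CardyIKTransportCornerLineDescentCrudeContinuity
import Literature.Probability.Percolation.QuadCrossingContinuityEventsDischarge
import HarnessLib

/-!
# Stub `stub_coveringBridgeShift` (S5') of line `five-arm-null` (skeleton v3, shifted family) for the crux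
`CardyFlipRusso.CoveringLeg` — Kesten's covering bridge by a collar squeeze

Route `CardyFlipRusso`, sub-problem `CriticalPhenomena/CardyFormulaZ2`, crux item stmt-CriticalPhenomena-6435
(`Summit.CriticalPhenomena.CardyFormulaZ2.Theses.CardyFlipRusso.CoveringLeg`), skeleton v3 "shifted family"
`Cruxes/CoveringLeg/Lines/five_arm_null.lean` (lead `prover-line-stmt-CriticalPhenomena-6435-c1-0`).  This helper
file (`--supports stmt-CriticalPhenomena-6435`) PROVES

* the registered helper stub `coveringBridge_translate_of_lower`: GIVEN the lower inclusion "thinned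
  collar-to-collar crude bond crossing of `R` ⟹ crude site crossing of the translate `R + δw` in Kesten's covering
  configuration" (landed separately as `cover_lowerCrossing_subset_crossS_shift`, and taken here VERBATIM as the
  hypothesis), Cardy's formula for the crude mixed crossing probabilities `P_{1/2,0}[cross (R + δw, δ)]` at `q = 0`
  of the translated family (every `R`, one fixed `w ∈ ℂ`) implies Cardy's formula for crude bond-`ℤ²` crossings
  (`BondCardy`);
* the registered skeleton stub `stub_coveringBridgeShift : MixedCardyZeroShift → BondCardy` (`w = i/√2`);
* route CardySectorGap's item `CoveringBridge` (stmt-CriticalPhenomena-7055) BY NAME (`w = 0`,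
  `coveringBridge_proof`).

THE ARGUMENT (fixed `R`, `w`; `δ → 0⁺`; `Pb = bondPercolation (zdGraph 2) half`).  Kesten's covering map pushes
`Pb` forward to Beffara's mixed law at `q = 0` (`cover_map_bondPercolation`), so
`P_{1/2,0}[cross (R + δw, δ)] = Pb[coverMap ⁻¹ cross (R + δw, δ)]` (`cover_real_preimage`, the event being
measurable by `cover_measurableSet_crossS`).  Deterministically, at mesh `δ`,

  `lowerCrossing R κ ρ δ ⊆ coverMap ⁻¹ cross (R + δw, δ) ⊆ upperCrossing R ρ δ`  (a.s.; `δ ≤ κ`, `δ (‖w‖ + 3) ≤ ρ`),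
  `lowerCrossing R κ ρ δ ⊆ crude bond crossing of R ⊆ upperCrossing R ρ δ`     (a.s.; `√2 δ ≤ κ`, `2 δ ≤ ρ`),

the first line by the hypothesis and by direction A of the covering dictionary (`cover_preimage_siteCross_subset`:
a site crossing of `(Ω + δw; A + δw, B + δw)` yields an open bond path in the `δ`-thickening of `Ω + δw` from
within `3δ` of `A + δw` to within `3δ` of `B + δw`, i.e. with all data within `δ (‖w‖ + 3)` of the UNtranslated
`(Ω; A, B)` — `coverShift_preimage_crossS_subset_upper`), the second line by the tree's sandwich
`Freeze.lowerCrossing_subset_embDomainCrossing`, `Freeze.embDomainCrossing_subset_upperCrossing`.  The tree's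
PROVED mesh-uniform continuity of crude bond-`ℤ²` crossing probabilities in the discretisation of the domain
(`stub_CrudeCrossingContinuity_of_SS` ∘ `QuadCrossing.SchrammSmirnov2011_lemma_5_1_holds`:
`∀ ε > 0 ∃ κ, ρ > 0 ∀ᶠ δ → 0⁺, Pb[upper] ≤ Pb[lower] + ε`) then squeezes
`|P_{1/2,0}[cross (R + δw, δ)] − Pb[crude (R, δ)]| ≤ ε` eventually (`coverShift_sandwich`,
`coverShift_tendsto_sub`), so the two families have the same limit inside every uniformizing datum of `R`.

References: H. Kesten, *Percolation theory for mathematicians* (1982) §3.4 [Kesten1982]; V. Beffara, *Is critical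
2D percolation universal?*, Progr. Probab. 60 (2008) §5.1 [Beffara2008Universal]; O. Schramm, S. Smirnov,
*On the scaling limits of planar percolation*, Ann. Probab. 39 (2011) Lemma 5.1 [SchrammSmirnov2011].
-/

noncomputable section

namespace Summit.CriticalPhenomena.CardyFormulaZ2.Cruxes.CoveringLeg.FiveArmNull

open MeasureTheory Measure ProbabilityTheory Filter Set Topology
open Literature.Probability.LatticeModels
open Literature.Probability.Percolation
open Literature.Probability.RandomPlanarGeometry
open Literature.Barriers.CriticalPhenomena (MixedSite mixedParam)
open Summit.CriticalPhenomena.CardyFormulaZ2.Theses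
open Summit.CriticalPhenomena.CardyFormulaZ2.Theorems.CornerLineDescent.SymmetricSeed

/-! ### Metric bookkeeping for the translation `z ↦ z + t` -/

/-- `‖δ w‖ = δ ‖w‖` for `δ > 0`. [folklore] -/
theorem coverShift_norm_mul {δ : ℝ} (hδ : 0 < δ) (w : ℂ) : ‖(δ : ℂ) * w‖ = δ * ‖w‖ := by
  rw [norm_mul, Complex.norm_real, Real.norm_of_nonneg hδ.le]

/-- The translation `similarity 1 _ t = (· + t)` is an isometry of the plane. [folklore] -/
theorem coverShift_isometry (t : ℂ) : Isometry (similarity 1 one_ne_zero t) :=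
  Isometry.of_dist_eq fun p q => by simp only [similarity_apply, one_mul, dist_add_right]

/-- Distance to a translate: `infDist p (A + t) = infDist (p − t) A`. [folklore] -/
theorem coverShift_infDist_image (p t : ℂ) (A : Set ℂ) :
    Metric.infDist p (similarity 1 one_ne_zero t '' A) = Metric.infDist (p - t) A :=
  calc Metric.infDist p (similarity 1 one_ne_zero t '' A)
      = Metric.infDist (similarity 1 one_ne_zero t (p - t)) (similarity 1 one_ne_zero t '' A) := by
        rw [similarity_apply, one_mul, sub_add_cancel]
    _ = Metric.infDist (p - t) A := Metric.infDist_image (coverShift_isometry t)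

/-- `infDist p A ≤ infDist p (A + t) + ‖t‖`. [folklore] -/
theorem coverShift_infDist_le (p t : ℂ) (A : Set ℂ) :
    Metric.infDist p A ≤ Metric.infDist p (similarity 1 one_ne_zero t '' A) + ‖t‖ := by
  rw [coverShift_infDist_image]
  have h := Metric.infDist_le_infDist_add_dist (s := A) (x := p) (y := p - t)
  rwa [dist_eq_norm, sub_sub_cancel] at h

/-- A point of the `δ`-thickening of the translate `A + t` is within `δ + ‖t‖` of `A`. [folklore] -/
theorem coverShift_infDist_le_of_mem_thickening {δ : ℝ} {p t : ℂ} {A : Set ℂ}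
    (h : p ∈ Metric.thickening δ (similarity 1 one_ne_zero t '' A)) :
    Metric.infDist p A ≤ δ + ‖t‖ := by
  rw [Metric.mem_thickening_iff] at h
  obtain ⟨z, ⟨a, ha, rfl⟩, hz⟩ := h
  rw [similarity_apply, one_mul] at hz
  have h1 : Metric.infDist p A ≤ dist p a := Metric.infDist_le_dist_of_mem ha
  have h2 : dist p a ≤ dist p (a + t) + dist (a + t) a := dist_triangle _ _ _
  rw [dist_eq_norm (a + t) a, add_sub_cancel_left] at h2
  linarith

/-! ### (i) The upper inclusion for the translated family -/

/-- **The covering preimage of the translated site event lies in the fattened bond event.**  For `0 < δ` and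
`δ (‖w‖ + 3) ≤ ρ`: if Kesten's covering configuration `coverMap η` has a crude site crossing of the translate
`R + δw` at mesh `δ` (event `crossS`, frame `zS`, graph `G_s`), then `η` has an open bond path of `ℤ²` (frame
`squareLatticeEmbedding.z`, mesh `δ`) all of whose vertices are within `ρ` of `R.carrier`, from within `ρ` of
`arc 0` to within `ρ` of `arc 2` (`Freeze.upperCrossing R ρ δ`): direction A of the covering dictionary puts the
path in the `δ`-thickening of `Ω + δw` with ends within `3δ` of the translated arcs, and undoing the translation
costs `δ ‖w‖`. [cite: Kesten1982, §3.4] -/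
theorem coverShift_preimage_crossS_subset_upper (R : ConformalRectangle) (w : ℂ) {δ ρ : ℝ} (hδ : 0 < δ)
    (hρ : δ * (‖w‖ + 3) ≤ ρ) :
    coverMap ⁻¹' crossS (R.map (similarity 1 one_ne_zero ((δ : ℂ) * w))) δ ⊆ Freeze.upperCrossing R ρ δ := by
  rw [crossS_eq, gsGraph_eq, cover_zS_eq, MarkedDomain.carrier_map, MarkedDomain.arc_map, MarkedDomain.arc_map]
  have hn : ‖(δ : ℂ) * w‖ = δ * ‖w‖ := coverShift_norm_mul hδ w
  have hρ' : δ * ‖w‖ + 3 * δ ≤ ρ := by linarith [mul_add δ ‖w‖ 3, mul_comm δ (3 : ℝ)]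
  refine (cover_preimage_siteCross_subset _ _ _ hδ).trans (cover_openCrossing_mono ?_ ?_ ?_)
  · intro y hy
    simp only [Set.mem_setOf_eq] at hy ⊢
    have h := coverShift_infDist_le_of_mem_thickening hy
    rw [hn] at h
    linarith
  · intro u hu
    simp only [Set.mem_setOf_eq] at hu ⊢
    have h := (coverShift_infDist_le _ ((δ : ℂ) * w) (R.arc 0)).trans (add_le_add hu le_rfl)
    rw [hn] at h
    linarith
  · intro v hv
    simp only [Set.mem_setOf_eq] at hv ⊢
    have h := (coverShift_infDist_le _ ((δ : ℂ) * w) (R.arc 2)).trans (add_le_add hv le_rfl)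
    rw [hn] at h
    linarith

/-! ### (ii)–(iii) The fixed-mesh squeeze -/

/-- **The fixed-mesh squeeze.**  Let the lower inclusion hold (hypothesis `hlow`, the text of
`cover_lowerCrossing_subset_crossS_shift`).  At a mesh `δ > 0` with `2δ ≤ κ` and `δ (‖w‖ + 3) ≤ ρ`, if the
fattened bond event exceeds the thinned collar-to-collar bond event in `P_{1/2}`-probability by at most `ε`, then
the crude mixed crossing probability of the translate `R + δw` at `q = 0` and the crude bond crossing probability
of `R` differ by at most `ε`: both lie between `Pb[lowerCrossing R κ ρ δ]` and `Pb[upperCrossing R ρ δ]`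
(Kesten's coupling `P_{1/2,0} = coverMap_* Pb`, the two deterministic sandwiches, and the a.s. lattice condition
`η ⊆ E(ℤ²)`). [cite: Kesten1982, §3.4] -/
theorem coverShift_sandwich
    (hlow : ∀ (R : ConformalRectangle) (w : ℂ) (κ ρ δ : ℝ), 0 < δ → δ ≤ κ → δ * (‖w‖ + 1) ≤ ρ →
      ∀ (η : Set (Sym2 (Site 2))), η ⊆ (zdGraph 2).edgeSet → η ∈ Freeze.lowerCrossing R κ ρ δ →
        coverMap η ∈ crossS (R.map (similarity 1 one_ne_zero ((δ : ℂ) * w))) δ)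
    (R : ConformalRectangle) (w : ℂ) {κ ρ δ ε : ℝ} (hδ : 0 < δ) (hδκ : 2 * δ ≤ κ)
    (hδρ : δ * (‖w‖ + 3) ≤ ρ)
    (hC : (bondPercolation (zdGraph 2) half).real (Freeze.upperCrossing R ρ δ) ≤
      (bondPercolation (zdGraph 2) half).real (Freeze.lowerCrossing R κ ρ δ) + ε) :
    (lawP 0).real (crossS (R.map (similarity 1 one_ne_zero ((δ : ℂ) * w))) δ) ≤ bondProb R δ + ε ∧
      bondProb R δ ≤ (lawP 0).real (crossS (R.map (similarity 1 one_ne_zero ((δ : ℂ) * w))) δ) + ε := by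
  have hw : 0 ≤ ‖w‖ := norm_nonneg w
  have hδw : 0 ≤ δ * ‖w‖ := mul_nonneg hδ.le hw
  have hexp : δ * (‖w‖ + 3) = δ * ‖w‖ + 3 * δ := by ring
  have h2ρ : 2 * δ ≤ ρ := by linarith
  have h1ρ : δ * (‖w‖ + 1) ≤ ρ := by linarith [mul_add δ ‖w‖ 1, mul_one δ]
  have hρ0 : 0 ≤ ρ := by linarith
  have hδκ' : δ ≤ κ := by linarith
  have hsq : Real.sqrt 2 * δ ≤ κ := by
    have h2 : Real.sqrt 2 ≤ 2 := (Real.sqrt_le_left zero_le_two).2 (by norm_num)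
    nlinarith
  have hae : ∀ᵐ η ∂ bondPercolation (zdGraph 2) half, η ⊆ (zdGraph 2).edgeSet := setBernoulli_ae_subset
  -- the crude bond event is below the fattened event
  have hcrU : bondProb R δ ≤ (bondPercolation (zdGraph 2) half).real (Freeze.upperCrossing R ρ δ) :=
    measureReal_mono (Freeze.embDomainCrossing_subset_upperCrossing R hδ.le h2ρ)
  -- the thinned event is below the crude bond event (a.s.)
  have hLcr : (bondPercolation (zdGraph 2) half).real (Freeze.lowerCrossing R κ ρ δ) ≤ bondProb R δ := by
    refine ENNReal.toReal_mono (measure_ne_top _ _) (measure_mono_ae ?_)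
    filter_upwards [hae] with η hη hL
    exact Freeze.lowerCrossing_subset_embDomainCrossing R hδ hρ0 hsq hη hL
  -- the thinned event is below the covering preimage of the translated site event (a.s.; the hypothesis)
  have hLpre : (bondPercolation (zdGraph 2) half).real (Freeze.lowerCrossing R κ ρ δ) ≤
      (bondPercolation (zdGraph 2) half).real
        (coverMap ⁻¹' crossS (R.map (similarity 1 one_ne_zero ((δ : ℂ) * w))) δ) := by
    refine ENNReal.toReal_mono (measure_ne_top _ _) (measure_mono_ae ?_)
    filter_upwards [hae] with η hη hL
    exact hlow R w κ ρ δ hδ hδκ' h1ρ η hη hL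
  -- the covering preimage is below the fattened event
  have hpreU : (bondPercolation (zdGraph 2) half).real
        (coverMap ⁻¹' crossS (R.map (similarity 1 one_ne_zero ((δ : ℂ) * w))) δ) ≤
      (bondPercolation (zdGraph 2) half).real (Freeze.upperCrossing R ρ δ) :=
    measureReal_mono (coverShift_preimage_crossS_subset_upper R w hδ hδρ)
  -- Kesten's coupling: the mixed probability IS the bond probability of the covering preimage
  have hpw : (lawP 0).real (crossS (R.map (similarity 1 one_ne_zero ((δ : ℂ) * w))) δ) =
      (bondPercolation (zdGraph 2) half).real
        (coverMap ⁻¹' crossS (R.map (similarity 1 one_ne_zero ((δ : ℂ) * w))) δ) :=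
    cover_real_preimage (cover_measurableSet_crossS _ hδ.ne')
  rw [hpw]
  constructor
  · linarith
  · linarith

/-! ### (iv) The two families are asymptotically equal -/

/-- **The difference of the two families tends to zero.**  Under the lower inclusion `hlow`, for every conformal
rectangle `R` and every `w ∈ ℂ`, `P_{1/2,0}[cross (R + δw, δ)] − Pb[crude bond crossing of (R, δ)] → 0` as
`δ → 0⁺`: given `ε > 0`, the tree's PROVED mesh-uniform continuity of crude bond-`ℤ²` crossing probabilities
(`stub_CrudeCrossingContinuity_of_SS` at Schramm–Smirnov's Lemma 5.1, `SchrammSmirnov2011_lemma_5_1_holds`)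
supplies `κ, ρ > 0` with `Pb[upper] ≤ Pb[lower] + ε/2` for all small `δ`, and `coverShift_sandwich` applies once
moreover `δ < κ/2` and `δ < ρ/(‖w‖ + 3)`. [cite: SchrammSmirnov2011, Lemma 5.1] -/
theorem coverShift_tendsto_sub
    (hlow : ∀ (R : ConformalRectangle) (w : ℂ) (κ ρ δ : ℝ), 0 < δ → δ ≤ κ → δ * (‖w‖ + 1) ≤ ρ →
      ∀ (η : Set (Sym2 (Site 2))), η ⊆ (zdGraph 2).edgeSet → η ∈ Freeze.lowerCrossing R κ ρ δ →
        coverMap η ∈ crossS (R.map (similarity 1 one_ne_zero ((δ : ℂ) * w))) δ)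
    (R : ConformalRectangle) (w : ℂ) :
    Tendsto (fun δ : ℝ =>
      (lawP 0).real (crossS (R.map (similarity 1 one_ne_zero ((δ : ℂ) * w))) δ) - bondProb R δ)
      (𝓝[>] 0) (𝓝 0) := by
  rw [Metric.tendsto_nhds]
  intro ε hε
  obtain ⟨κ, hκ, ρ, hρ, hev⟩ :=
    stub_CrudeCrossingContinuity_of_SS QuadCrossing.SchrammSmirnov2011_lemma_5_1_holds R (ε / 2) (half_pos hε)
  have hW : (0 : ℝ) < ‖w‖ + 3 := by positivity
  have hδ₀ : (0 : ℝ) < min (κ / 2) (ρ / (‖w‖ + 3)) := lt_min (half_pos hκ) (div_pos hρ hW)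
  filter_upwards [hev, Ioo_mem_nhdsGT hδ₀] with δ hC hδI
  have hδ : 0 < δ := hδI.1
  have hδκ : 2 * δ ≤ κ := by
    have h := lt_of_lt_of_le hδI.2 (min_le_left _ _)
    linarith
  have hδρ : δ * (‖w‖ + 3) ≤ ρ := by
    have h := lt_of_lt_of_le hδI.2 (min_le_right _ _)
    rw [lt_div_iff₀ hW] at h
    exact h.le
  obtain ⟨h1, h2⟩ := coverShift_sandwich hlow R w hδ hδκ hδρ hC
  rw [Real.dist_0_eq_abs, abs_sub_lt_iff]
  constructor <;> linarith

/-! ### The registered stubs -/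

/-- **Registered helper stub `coveringBridge_translate_of_lower` (skeleton v3, line `five-arm-null`).**  If the
thinned collar-to-collar crude bond crossing of every conformal rectangle `R` forces, in Kesten's covering
configuration, a crude site crossing of the translate `R + δw` on `G_s` (the lower inclusion, hypothesis), then for
every fixed `w ∈ ℂ`: Cardy's formula for the crude mixed crossing probabilities `P_{1/2,0}[cross (R + δw, δ)]` of
the translated family (all `R`) implies Cardy's formula for crude bond-`ℤ²` crossings (`BondCardy`) — one
`Tendsto.sub` with `coverShift_tendsto_sub` inside each uniformizing datum. [cite: Kesten1982, §3.4] -/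
theorem coveringBridge_translate_of_lower : (∀ (R : Literature.Probability.RandomPlanarGeometry.ConformalRectangle) (w : ℂ) (κ ρ δ : ℝ), 0 < δ → δ ≤ κ → δ * (‖w‖ + 1) ≤ ρ → ∀ (η : Set (Sym2 (Literature.Probability.LatticeModels.Site 2))), η ⊆ (Literature.Probability.LatticeModels.zdGraph 2).edgeSet → η ∈ Summit.CriticalPhenomena.CardyFormulaZ2.Theorems.CornerLineDescent.SymmetricSeed.Freeze.lowerCrossing R κ ρ δ → Summit.CriticalPhenomena.CardyFormulaZ2.Cruxes.CoveringLeg.FiveArmNull.coverMap η ∈ Summit.CriticalPhenomena.CardyFormulaZ2.Cruxes.CoveringLeg.FiveArmNull.crossS (R.map (Literature.Probability.RandomPlanarGeometry.similarity 1 one_ne_zero ((δ : ℂ) * w))) δ) → ∀ w : ℂ, (∀ R : Literature.Probability.RandomPlanarGeometry.ConformalRectangle, R.HasCrossingLimit (fun δ : ℝ => (Summit.CriticalPhenomena.CardyFormulaZ2.Cruxes.CoveringLeg.FiveArmNull.lawP 0).real (Summit.CriticalPhenomena.CardyFormulaZ2.Cruxes.CoveringLeg.FiveArmNull.crossS (R.map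 (Literature.Probability.RandomPlanarGeometry.similarity 1 one_ne_zero ((δ : ℂ) * w))) δ)) Literature.Probability.RandomPlanarGeometry.cardyFunction) → Summit.CriticalPhenomena.CardyFormulaZ2.Cruxes.CoveringLeg.FiveArmNull.BondCardy := by
  intro hlow w hw R φ x hφ
  have h := (hw R φ x hφ).sub (coverShift_tendsto_sub hlow R w)
  simp only [sub_sub_cancel, sub_zero] at h
  exact h

/-- **Registered stub S5' `stub_coveringBridgeShift` — KESTEN'S COVERING BRIDGE, shifted family**
(`MixedCardyZeroShift → BondCardy`): the helper stub at `w = i/√2` with the landed lower inclusion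
`cover_lowerCrossing_subset_crossS_shift`. [cite: Kesten1982, §3.4] -/
theorem stub_coveringBridgeShift :
    Summit.CriticalPhenomena.CardyFormulaZ2.Cruxes.CoveringLeg.FiveArmNull.Sig.stub_coveringBridgeShift := by
  intro h
  exact coveringBridge_translate_of_lower cover_lowerCrossing_subset_crossS_shift
    (Complex.I / (Real.sqrt 2 : ℂ)) h

/-- **Route CardySectorGap's `CoveringBridge` (stmt-CriticalPhenomena-7055) BY NAME**: Cardy for the crude mixed
crossing at `q = 0` (`MixedCardyZero`, the untranslated family) implies Cardy for crude bond-`ℤ²` crossings — the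
helper stub at `w = 0` (`R + δ·0 = R`, `map_similarity_one_zero`). [cite: Kesten1982, §3.4] -/
theorem coveringBridge_proof : Summit.CriticalPhenomena.CardyFormulaZ2.Theses.CardySectorGap.CoveringBridge := by
  rw [coveringBridge_iff]
  intro hM
  refine coveringBridge_translate_of_lower cover_lowerCrossing_subset_crossS_shift 0 fun R => ?_
  have h := hM R
  simpa only [mul_zero, map_similarity_one_zero] using h

end Summit.CriticalPhenomena.CardyFormulaZ2.Cruxes.CoveringLeg.FiveArmNull

end
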